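import Summits.BirchSwinnertonDyer.BirchSwinnertonDyer.Theorems.KolyvaginRoadThreeMethod2BipartiteFirstFloor
import Summits.BirchSwinnertonDyer.BirchSwinnertonDyer.Theorems.KolyvaginRoadThreePTEngineUnconditional
import HarnessLib

/-!
# Route `KolyvaginRoadThree`, crux `ZhangSharpFrameAtThreeHL` (item stmt-BirchSwinnertonDyer-19574): THE METHOD LINE'S TERMINAL
# STATE IN BIPARTITE CURRENCY — the crux BY NAME from the route's two published-input binders and ONE mod-3 bipartite datum with its
# rank-0 anchor at every Hoffstein–Luo A1 frame
# (cell `bsd-stepL`, seat `bsd-stepL-zhang3-w2` g0; `--supports stmt-BirchSwinnertonDyer-19574`, helper; assembles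
# `KolyvaginRoadThreeMethod2LevelSystemsOfBipartite` (p682024) + `KolyvaginRoadThreeMethod2BipartiteFirstFloor` with koly3b g10's
# terminal certificate `PTAt.zhangSharpFrameAtThreeHL_of_routeBinders_of_bottom_of_levelSystems'` (p584651))

WHAT. The registered METHOD line v3.2 of crux 19574 (`Cruxes/ZhangSharpFrameAtThreeHL/Lines/method2.lean`, skeleton 2e396e49c718) has the
terminal kernel state «crux BY NAME ⟸ h₁ + hCT3 + S1 + S2-KS» (`h₁ = PublishedInputsKolyThree`, `hCT3 = ShimuraCasselsTateLevelInputs` are the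
route's own `closes` binders feeding stub P; S1 = `stub_bottomRankOneAtThree`, S2-KS = `stub_levelKolyvaginSystemsAtThree`; stub A landed,
S2-ENGINE a theorem). The two companion files give S2-KS's text (`stub_levelKolyvaginSystemsAtThree_of_bipartite'`) and S1's text
(`stub_bottomRankOneAtThree_of_bipartite`) at a frame from ONE mod-3 bipartite datum with its anchor. THIS FILE:

* `zhangSharpFrameAtThreeHL_of_routeBinders_of_bipartite` — **the crux `ZhangSharpFrameAtThreeHL` BY NAME from `h₁ + hCT3` and ONE
  hypothesis `hBES`: at every HL A1 frame, for every complex conjugation `c ≠ 1` and the `ZMod 3`-structure of `H¹(K, E[3])`, there EXIST signs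
  `ε₀`, even-level classes `κ₀`, odd-level values `λ` with `realisation`, the five local axioms at even good levels, (A⇐), (B⇒) and the anchor
  (γ)** — S1 and S2-KS by the companions, then koly3b's terminal certificate; complex conjugation `c ≠ 1` for S1's frames from `|Aut(K/ℚ)| = [K : ℚ] = 2`. KERNEL READING of the line's residual, in the printed shape: a mod-3
  BIPARTITE EULER SYSTEM for `(E, K, 3)` on the good unipotent-admissible levels extending E's Kolyvagin classes (W. Zhang §3 + Thm 4.3's two
  halves = BD05 Thms 4.1 ∕ 4.2 at `p = 3 ∥ N`: the card's bricks R2 ∕ R4 ∕ R6) together with the rank-0 anchor at the DEFINITE levels (Zhang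
  Thm 7.1 at `p = 3`: brick R7) — nothing else of the E-side remains in S1 ∪ S2-KS.


HONEST FRAMING: one theorem; 0 definitions, 0 named facts, 0 `sorry`; CONDITIONAL — `h₁`, `hCT3` (published inputs, the route's binders) and
`hBES` (the bipartite datum with laws and anchor at every frame: NOT in print at `p = 3`, the crux's residual content) are HYPOTHESES; closes
nothing (T7): the crux is NOT proved by this. This module imports the route file (through the terminal certificate) by necessity: it concludes
the route's decl. PARTITION: O2@3 (B10) × A1 × crux 19574 — proves-glue (terminal certificate in bipartite currency). BSD is not proved by any
of this.

References: [cite: WZhang2014, §3, Thm. 4.3, Thm. 7.1, Thm. 7.2, §9 (proof of Thm. 9.1), Thm. 9.2] [cite: BertoliniDarmon2005, Thm. 4.1,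
Thm. 4.2] [cite: GrossLMS1991, Prop. 2.3].
-/

noncomputable section

open scoped Classical

namespace Summit.BirchSwinnertonDyer.Rank1Residual.X11b.Three.Koly.Method2Bipartite

open WeierstrassCurve NumberField IsDedekindDomain
  Literature.NumberTheory.EllipticCurves Literature.NumberTheory.EllipticCurves.ModularForms
  Literature.NumberTheory.GaloisRepresentations Module

open Summit.BirchSwinnertonDyer.Rank1Residual.X11b.Three.Koly.Method2

/-- **THE METHOD LINE'S TERMINAL STATE IN BIPARTITE CURRENCY: the crux `ZhangSharpFrameAtThreeHL` BY NAME from the route's two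
published-input binders `h₁ = PublishedInputsKolyThree`, `hCT3 = ShimuraCasselsTateLevelInputs` (which feed stub P, koly g16 p522478) and
ONE hypothesis `hBES`: at every Hoffstein–Luo A1 frame, for every complex conjugation `c ≠ 1` and the `ZMod 3`-structure of `H¹(K, E[3])`,
there EXIST signs `ε₀`, even-level classes `κ₀(m, n) ∈ H¹(K, E[3])` and odd-level values `λ(m, n) ∈ 𝔽₃` on the good unipotent-admissible
levels with — `realisation` at `∅` (the frame's Kolyvagin classes mod 3), the five local axioms `sign` ∕ `selmer_off` ∕ `ordinary_on` ∕
`transverse_on` ∕ `relation` at even good non-empty levels, the reciprocity halves (A⇐) ∕ (B⇒), and the rank-0 anchor (γ) at odd good levels.**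
Proof: S1's text by §2, S2-KS's text by §1, then koly3b g10's terminal certificate `PTAt.zhangSharpFrameAtThreeHL_of_routeBinders_of_bottom_
of_levelSystems'` (crux ⟸ h₁ + hCT3 + S1 + S2-KS; stub P from h₁ + hCT3, stub A landed, S2-ENGINE a theorem). `hBES` is, in the printed
shape, W. Zhang's §3 (level raising at `3 ∥ N` + the classes (3.30) with their local conditions), Thm 4.3's two halves (BD05 Thms 4.1 ∕ 4.2)
and Thm 7.1 (the anchor at the definite levels) RUN AT `p = 3` on good unipotent-admissible levels — the card's bricks R2 ∕ R4 ∕ R6 ∕ R7; it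
is NOT asserted here. [cite: WZhang2014, §3, Thm. 4.3, Thm. 7.1, Thm. 7.2, §9 (proof of Thm. 9.1), Thm. 9.2]
[cite: BertoliniDarmon2005, Thm. 4.1, Thm. 4.2] [cite: GrossLMS1991, Prop. 2.3] -/
theorem zhangSharpFrameAtThreeHL_of_routeBinders_of_bipartite
    (h₁ : Summit.BirchSwinnertonDyer.BirchSwinnertonDyer.Theses.KolyvaginRoadThree.PublishedInputsKolyThree)
    (hCT3 : Summit.BirchSwinnertonDyer.BirchSwinnertonDyer.Theses.KolyvaginRoadThree.ShimuraCasselsTateLevelInputs)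
    (hBES :
      ∀ (W : WeierstrassCurve ℚ) [W.IsElliptic] [W.IsGloballyMinimal] [NeZero (W.conductorNorm ℤ)] (K : Type)
        [Field K] [NumberField K] (Dt : ModularParametrizationData W (W.conductorNorm ℤ)) (β : ℤ) (ι : K →+* ℂ),
        Summit.BirchSwinnertonDyer.Rank1Residual.ClassX11b W 3 → W.HasMultiplicativeReductionAtPrime 3 →
        Rank1Residual.Surj W 3 → Rank1Residual.Ram W 3 → ¬ 3 ∣ W.tamagawaProduct → IsImaginaryQuadratic K →
        Odd (NumberField.discr K) → SatisfiesHeegnerHypothesis (W.conductorNorm ℤ) K →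
        (W.quadraticTwist (NumberField.discr K : ℚ)).entireLFunction 1 ≠ 0 → NumberField.discr K ≠ -3 →
        (4 * (W.conductorNorm ℤ : ℤ)) ∣ β ^ 2 - NumberField.discr K → ¬ (3 : ℤ) ∣ Dt.c →
        ∀ (c : K ≃ₐ[ℚ] K), c ≠ 1 → ∀ [Module (ZMod 3) (V3 W K)],
        ∃ (ε₀ : Finset {q // IsUAdmissiblePrime W K q} → Bool)
          (κ₀ : Finset {ℓ // Zhang2014.IsKolyvaginPrime (W.conductorNorm ℤ) W K 3 ℓ} →
            Finset {q // IsUAdmissiblePrime W K q} → V3 W K)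
          (lam : Finset {ℓ // Zhang2014.IsKolyvaginPrime (W.conductorNorm ℤ) W K 3 ℓ} →
            Finset {q // IsUAdmissiblePrime W K q} → ZMod 3),
        -- realisation at `∅`
        (∀ m : Finset {ℓ // Zhang2014.IsKolyvaginPrime (W.conductorNorm ℤ) W K 3 ℓ},
          ∃ d : KolyvaginHeegnerData Dt β ι (∏ ℓ ∈ m, (ℓ : ℕ)), κ₀ m ∅ = d.kolyvaginClass Nat.prime_three 1) ∧
        -- sign
        (∀ n, GoodLevel W K n → n.Nonempty → Even n.card →
          ∀ m : Finset {ℓ // Zhang2014.IsKolyvaginPrime (W.conductorNorm ℤ) W K 3 ℓ},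
          conjAct W c ((3 ^ 1 : ℕ) : ℤ) (κ₀ m n) = sgn (ε₀ n ^^ Nat.bodd m.card) • κ₀ m n) ∧
        -- selmer_off
        (∀ n, GoodLevel W K n → n.Nonempty → Even n.card →
          ∀ (m : Finset {ℓ // Zhang2014.IsKolyvaginPrime (W.conductorNorm ℤ) W K 3 ℓ}) (v : HeightOneSpectrum (𝓞 K)),
          (∀ ℓ ∈ m, ((ℓ : ℕ) : 𝓞 K) ∉ v.asIdeal) → (∀ q ∈ n, ((q : ℕ) : 𝓞 K) ∉ v.asIdeal) →
          κ₀ m n ∈ selmerLocalKer (W.baseChange K) (v.adicCompletion K) ((3 ^ 1 : ℕ) : ℤ)) ∧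
        -- ordinary_on
        (∀ n, GoodLevel W K n → n.Nonempty → Even n.card →
          ∀ m : Finset {ℓ // Zhang2014.IsKolyvaginPrime (W.conductorNorm ℤ) W K 3 ℓ}, ∀ q ∈ n,
          ∀ v : HeightOneSpectrum (𝓞 K), ((q : ℕ) : 𝓞 K) ∈ v.asIdeal →
          κ₀ m n ∈ (W.baseChange K).ordinaryLocalKer (v.adicCompletion K) ((3 ^ 1 : ℕ) : ℤ)) ∧
        -- transverse_on
        (∀ n, GoodLevel W K n → n.Nonempty → Even n.card →
          ∀ m : Finset {ℓ // Zhang2014.IsKolyvaginPrime (W.conductorNorm ℤ) W K 3 ℓ}, ∀ ℓ ∈ m,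
          ∀ v : HeightOneSpectrum (𝓞 K), ((ℓ : ℕ) : 𝓞 K) ∈ v.asIdeal → κ₀ m n ∈ transverseLocalKer W K ι ℓ v) ∧
        -- relation (8.1)
        (∀ n, GoodLevel W K n → n.Nonempty → Even n.card →
          ∀ (m : Finset {ℓ // Zhang2014.IsKolyvaginPrime (W.conductorNorm ℤ) W K 3 ℓ})
            (ℓ : {ℓ // Zhang2014.IsKolyvaginPrime (W.conductorNorm ℤ) W K 3 ℓ}), ℓ ∉ m → ∀ v : HeightOneSpectrum (𝓞 K),
          ((ℓ : ℕ) : 𝓞 K) ∈ v.asIdeal →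
          (κ₀ (insert ℓ m) n ∈ (W.baseChange K).torsionLocalKer (v.adicCompletion K) ((3 ^ 1 : ℕ) : ℤ) ↔
            κ₀ m n ∈ (W.baseChange K).torsionLocalKer (v.adicCompletion K) ((3 ^ 1 : ℕ) : ℤ))) ∧
        -- (A⇐)
        (∀ (n : Finset {q // IsUAdmissiblePrime W K q}) (q : {q // IsUAdmissiblePrime W K q}),
          GoodLevel W K (insert q n) → Even n.card → q ∉ n →
          ∀ m : Finset {ℓ // Zhang2014.IsKolyvaginPrime (W.conductorNorm ℤ) W K 3 ℓ},
          lam m (insert q n) ≠ 0 → ∃ v : HeightOneSpectrum (𝓞 K), ((q : ℕ) : 𝓞 K) ∈ v.asIdeal ∧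
            κ₀ m n ∉ (W.baseChange K).torsionLocalKer (v.adicCompletion K) ((3 ^ 1 : ℕ) : ℤ)) ∧
        -- (B⇒)
        (∀ (n : Finset {q // IsUAdmissiblePrime W K q}) (q : {q // IsUAdmissiblePrime W K q}),
          GoodLevel W K (insert q n) → Odd n.card → q ∉ n →
          ∀ (m : Finset {ℓ // Zhang2014.IsKolyvaginPrime (W.conductorNorm ℤ) W K 3 ℓ}) (v : HeightOneSpectrum (𝓞 K)),
          ((q : ℕ) : 𝓞 K) ∈ v.asIdeal →
          κ₀ m (insert q n) ∉ (W.baseChange K).torsionLocalKer (v.adicCompletion K) ((3 ^ 1 : ℕ) : ℤ) →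
          lam m n ≠ 0) ∧
        -- (γ)
        (∀ n : Finset {q // IsUAdmissiblePrime W K q}, GoodLevel W K n → Odd n.card →
          finrank (ZMod 3) (SelQ W K c n true) + finrank (ZMod 3) (SelQ W K c n false) = 0 → lam ∅ n ≠ 0)) :
    Summit.BirchSwinnertonDyer.BirchSwinnertonDyer.Theses.KolyvaginRoadThree.ZhangSharpFrameAtThreeHL := by
  refine PTAt.zhangSharpFrameAtThreeHL_of_routeBinders_of_bottom_of_levelSystems' h₁ hCT3 ?_ ?_
  · -- S1: at `dim = 1`, choose `c ≠ 1`, take the datum at `c`, read its first floor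
    intro W _ _ _ K _ _ Dt β ι hX hmult hsurj hram htam hK hodd hH hLt h3 hβ hc _ h1
    -- complex conjugation: `|Aut(K/ℚ)| = [K : ℚ] = 2`, so some `c ≠ 1`
    obtain ⟨c, hc1⟩ : ∃ c : K ≃ₐ[ℚ] K, c ≠ 1 := by
      haveI : Algebra.IsQuadraticExtension ℚ K := ⟨hK.1⟩
      have hcard : Nat.card (K ≃ₐ[ℚ] K) = 2 := by rw [IsGalois.card_aut_eq_finrank, hK.1]
      haveI : Finite (K ≃ₐ[ℚ] K) := Nat.finite_of_card_ne_zero (by rw [hcard]; decide)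
      haveI : Nontrivial (K ≃ₐ[ℚ] K) := Finite.one_lt_card_iff_nontrivial.mp (by rw [hcard]; decide)
      exact exists_ne 1
    obtain ⟨ε₀, κ₀, lam, realisation, -, -, -, -, -, lawA, -, anchor⟩ :=
      hBES W K Dt β ι hX hmult hsurj hram htam hK hodd hH hLt h3 hβ hc c hc1
    exact stub_bottomRankOneAtThree_of_bipartite W K Dt β ι hX hmult hsurj hram htam hK hodd hH hLt h3 hβ hc c hc1 κ₀ lam
      realisation lawA anchor h1
  · -- S2-KS: the datum at `c` is a level Kolyvagin system
    intro W _ _ _ K _ _ Dt β ι hX hmult hsurj hram htam hK hodd hH hLt h3 hβ hc c hc1 _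
    obtain ⟨ε₀, κ₀, lam, realisation, sign, selmer_off, ordinary_on, transverse_on, relation, lawA, lawB, anchor⟩ :=
      hBES W K Dt β ι hX hmult hsurj hram htam hK hodd hH hLt h3 hβ hc c hc1
    exact stub_levelKolyvaginSystemsAtThree_of_bipartite' W K Dt β ι hX hmult hsurj hram htam hK hodd hH hLt h3 hβ hc c hc1 ε₀
      κ₀ lam realisation sign selmer_off ordinary_on transverse_on relation lawA lawB anchor

end Summit.BirchSwinnertonDyer.Rank1Residual.X11b.Three.Koly.Method2Bipartite

end
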